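import Summits.ValiantsHypothesis.ValiantsHypothesis.Theorems.FeketeSOSFeketeSOSHardPaleyRIPTrade
import Summits.ValiantsHypothesis.ValiantsHypothesis.Theorems.FeketeSOSFeketeSOSHardPaleyRIPFlatOfDiscrepancy

/-!
# Route FeketeSOS — crux `FeketeSOSHard` (stmt-ValiantsHypothesis-3996), line `paley-rip`,
# stub `stub_paleyFlatRIP`: the engine ⟺ the Paley-ETF restricted isometry property beyond `√p`

The engine `stub_paleyFlatRIP` bounds the BILINEAR Paley–Hankel form `Σ_{a,b∈S} χ_p(a+b) w_a w_b`
(sum kernel, no conjugation).  The literature states the "Paley ETF conjecture" for the HERMITIAN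
Paley-graph form: the Paley equiangular tight frame `Φ_p` (`p ≡ 1 mod 4`; Gram matrix
`I + p^{−1/2}(χ_p(a−b))_{a≠b}`, Bandeira–Fickus–Mixon–Wong 2013 §6, Bandeira–Mixon–Moreira 2017) should
have the restricted isometry property at order `K = p^{1/2+δ}` with constant `p^{−κ}`, i.e.
`|Σ_{a,b∈S} χ_p(a−b) x_a conj(x_b)| ≤ p^{1/2−κ}‖x‖²` for all `#S ≤ K` — "breaking the square-root
bottleneck", listed OPEN as Conjecture 14 of Bandeira's *Open problems of 2025* (arXiv:2603.29571) and
the hypothesis of arXiv:2405.08608 Thm 18 / arXiv:2011.02907.  This file proves, sorry-free, that the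
two are the SAME statement up to exponents:

* `hermForm_eq_bilin_reflect`, `norm_hermForm_le_of_flat` — the Hermitian form on `S` is the bilinear
  Paley–Hankel block `S × (−S)` against `(x, conj x∘(−·))`, so the engine's bound on `S ∪ (−S)` gives the
  Hermitian bound on `S` (block polarisation `norm_paleyBilin_block_le`, `…PaleyRIPTrade.lean`);
* `hermForm_polarisation`, `norm_hermBilin_le_of_herm`, `norm_diffCharSum_le_of_herm` — sesquilinear
  polarisation `4B(x,y) = Σ_k i^k H(x + i^k y)` and the scaling `s·1_A, s⁻¹·1_B`: a Hermitian bound `θ`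
  on `T` gives flat Paley-graph discrepancy `|Σ_{A×B} χ_p(a−b)| ≤ 2θ√(#A#B)` for `A, B ⊆ T`;
* `paleyHermRIP_of_flatRIP` (exponents `(κ, δ₁/2)`), `paleyDiffDiscrepancy_of_paleyHermRIP`
  (`(κ/2, δ/2)`), and `flatRIP_iff_paleyHermRIP` — **engine ⟺ Paley-ETF RIP beyond `√p`**, closing with
  `flatRIP_iff_paleyDiffDiscrepancy` (`…FlatOfDiscrepancy.lean`).

With the sibling files the kernel now holds: `stub_paleyFlatRIP` ⟺ PaleySumDiscrepancy ⟺
PaleyDiffDiscrepancy ⟺ `∃α<1/2 𝒫(α,β)` (sum/difference) ⟺ Paley-ETF RIP beyond `√p`; each implies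
`ω(Paley_p) ≤ p^{1/2−κ}+1`; admissible exponents satisfy `κ + δ₁/2 ≤ 1/4` and trade at rate `2`.

Honest framing: equivalences between OPEN statements, landed `--supports` the crux item; the crux
`FeketeSOSHard`, the engine and `stub_tameOperator` remain open; nothing here bears on `VP ≠ VNP`.
-/

-- the line's namespace repeats a path segment by convention (same as the other paley-rip files)
set_option linter.dupNamespace false

namespace Summit.ValiantsHypothesis.ValiantsHypothesis.Theorems.FeketeSOSHardPaleyRIP

open Finset
open scoped BigOperators ComplexConjugate

noncomputable section

section Reflect

variable (p : ℕ) [Fact p.Prime]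

omit [Fact p.Prime] in
/-- The reflection `b ↦ (p − b) mod p` is an involution on `[0,p)`. [folklore] -/
theorem reflect_reflect (b : ℕ) (hb : b < p) : (p - (p - b) % p) % p = b := by
  rcases Nat.eq_zero_or_pos b with h0 | hpos
  · subst h0
    rw [Nat.sub_zero, Nat.mod_self, Nat.sub_zero, Nat.mod_self]
  · rw [Nat.mod_eq_of_lt (by omega : p - b < p), Nat.mod_eq_of_lt (by omega : p - (p - b) < p)]
    omega

/-- **The Hermitian Paley-graph form as a reflected bilinear Paley–Hankel sum.**  For `S ⊆ [0,p)`: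
`Σ_{a,b∈S} χ_p(a−b) x_a conj(x_b) = Σ_{a∈S} Σ_{c∈−S} χ_p(a+c) x_a · conj(x_{−c})` (`−S = {(p−b) mod p}`).
[folklore] -/
theorem hermForm_eq_bilin_reflect (S : Finset ℕ) (hS : ∀ b ∈ S, b < p) (x : ℕ → ℂ) :
    ∑ a ∈ S, ∑ b ∈ S, ((legendreSym p ((a : ℤ) - b) : ℤ) : ℂ) * x a * conj (x b) =
      ∑ a ∈ S, ∑ c ∈ S.image (fun b : ℕ => (p - b) % p),
        ((legendreSym p ((a : ℤ) + c) : ℤ) : ℂ) * x a * conj (x ((p - c) % p)) := by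
  refine sum_congr rfl fun a _ => ?_
  rw [sum_image (reflect_injOn p S hS)]
  refine sum_congr rfl fun b hb => ?_
  rw [legendreSym_add_reflect p a b (hS b hb), reflect_reflect p b (hS b hb)]

omit [Fact p.Prime] in
/-- The reflected conjugate weights have the same `ℓ²`-mass. [folklore] -/
theorem sum_norm_sq_reflect (S : Finset ℕ) (hS : ∀ b ∈ S, b < p) (x : ℕ → ℂ) :
    ∑ c ∈ S.image (fun b : ℕ => (p - b) % p), ‖conj (x ((p - c) % p))‖ ^ 2 =
      ∑ b ∈ S, ‖x b‖ ^ 2 := by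
  rw [sum_image (reflect_injOn p S hS)]
  refine sum_congr rfl fun b hb => ?_
  rw [reflect_reflect p b (hS b hb), Complex.norm_conj]

/-- **Engine ⇒ Paley-ETF RIP, at one prime and one support.**  If the Paley–Hankel form is `θ`-flat on
`S ∪ (−S)`, then the Hermitian Paley-graph form is `θ`-bounded on `S`:
`|Σ_{a,b∈S} χ_p(a−b) x_a conj(x_b)| ≤ θ Σ_{a∈S}|x_a|²` (the reflected bilinear block `S × (−S)`,
`norm_paleyBilin_block_le`). [folklore] -/
theorem norm_hermForm_le_of_flat (θ : ℝ) (S : Finset ℕ) (hS : ∀ b ∈ S, b < p)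
    (hQ : ∀ w : ℕ → ℂ, ‖paleyForm p (S ∪ S.image (fun b : ℕ => (p - b) % p)) w‖ ≤
      θ * ∑ a ∈ S ∪ S.image (fun b : ℕ => (p - b) % p), ‖w a‖ ^ 2) (x : ℕ → ℂ) :
    ‖∑ a ∈ S, ∑ b ∈ S, ((legendreSym p ((a : ℤ) - b) : ℤ) : ℂ) * x a * conj (x b)‖ ≤
      θ * ∑ a ∈ S, ‖x a‖ ^ 2 := by
  rw [hermForm_eq_bilin_reflect p S hS x]
  have h := norm_paleyBilin_block_le p θ S (S.image (fun b : ℕ => (p - b) % p)) hQ x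
    (fun c => conj (x ((p - c) % p)))
  rw [sum_norm_sq_reflect p S hS x, mul_assoc,
    Real.mul_self_sqrt (sum_nonneg fun _ _ => sq_nonneg _)] at h
  exact h

end Reflect

section Polarisation

variable (p : ℕ) [Fact p.Prime]

/-- **Sesquilinear polarisation** for the Hermitian Paley-graph form on `T`:
`4·B(x,y) = H(x+y) − H(x−y) + i·(H(x+iy) − H(x−iy))`, `B(x,y) = Σ χ_p(a−b) x_a conj(y_b)`,
`H(z) = B(z,z)`. [folklore] -/
theorem hermForm_polarisation (T : Finset ℕ) (x y : ℕ → ℂ) :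
    4 * ∑ a ∈ T, ∑ b ∈ T, ((legendreSym p ((a : ℤ) - b) : ℤ) : ℂ) * x a * conj (y b) =
      (∑ a ∈ T, ∑ b ∈ T, ((legendreSym p ((a : ℤ) - b) : ℤ) : ℂ) * (x a + y a) * conj (x b + y b)) -
      (∑ a ∈ T, ∑ b ∈ T, ((legendreSym p ((a : ℤ) - b) : ℤ) : ℂ) * (x a - y a) * conj (x b - y b)) +
      Complex.I * ((∑ a ∈ T, ∑ b ∈ T, ((legendreSym p ((a : ℤ) - b) : ℤ) : ℂ) *
          (x a + Complex.I * y a) * conj (x b + Complex.I * y b)) -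
        ∑ a ∈ T, ∑ b ∈ T, ((legendreSym p ((a : ℤ) - b) : ℤ) : ℂ) *
          (x a - Complex.I * y a) * conj (x b - Complex.I * y b)) := by
  rw [mul_sum, mul_sub, mul_sum, mul_sum, ← sum_sub_distrib, ← sum_sub_distrib, ← sum_add_distrib]
  refine sum_congr rfl fun a _ => ?_
  rw [mul_sum, mul_sum, mul_sum, ← sum_sub_distrib, ← sum_sub_distrib, ← sum_add_distrib]
  refine sum_congr rfl fun b _ => ?_
  have hI : Complex.I * Complex.I = -1 := Complex.I_mul_I
  simp only [map_add, map_sub, map_mul, Complex.conj_I]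
  linear_combination (((legendreSym p ((a : ℤ) - b) : ℤ) : ℂ) * (2 * x a * conj (y b) -
    2 * y a * conj (x b))) * hI

/-- `Σ_{a∈T} |x_a + i y_a|² + Σ_{a∈T} |x_a − i y_a|² = 2Σ|x_a|² + 2Σ|y_a|²`. [folklore] -/
theorem sum_norm_sq_add_I_mul (T : Finset ℕ) (x y : ℕ → ℂ) :
    (∑ a ∈ T, ‖x a + Complex.I * y a‖ ^ 2) + ∑ a ∈ T, ‖x a - Complex.I * y a‖ ^ 2 =
      2 * ∑ a ∈ T, ‖x a‖ ^ 2 + 2 * ∑ a ∈ T, ‖y a‖ ^ 2 := by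
  have h := sum_norm_sq_add_add_sum_norm_sq_sub T x (fun a => Complex.I * y a)
  have hI : ∑ a ∈ T, ‖Complex.I * y a‖ ^ 2 = ∑ a ∈ T, ‖y a‖ ^ 2 :=
    sum_congr rfl fun a _ => by rw [norm_mul, Complex.norm_I, one_mul]
  rw [hI] at h
  exact h

/-- **Hermitian bound ⇒ sesquilinear half-bound.**  If `|H(z)| ≤ θ Σ_{a∈T}|z_a|²` for all `z`, then
`|Σ_{a,b∈T} χ_p(a−b) x_a conj(y_b)| ≤ θ (Σ|x_a|² + Σ|y_a|²)`. [folklore] -/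
theorem norm_hermBilin_le_of_herm (θ : ℝ) (T : Finset ℕ)
    (hH : ∀ z : ℕ → ℂ, ‖∑ a ∈ T, ∑ b ∈ T, ((legendreSym p ((a : ℤ) - b) : ℤ) : ℂ) * z a * conj (z b)‖ ≤
      θ * ∑ a ∈ T, ‖z a‖ ^ 2) (x y : ℕ → ℂ) :
    ‖∑ a ∈ T, ∑ b ∈ T, ((legendreSym p ((a : ℤ) - b) : ℤ) : ℂ) * x a * conj (y b)‖ ≤
      θ * ((∑ a ∈ T, ‖x a‖ ^ 2) + ∑ a ∈ T, ‖y a‖ ^ 2) := by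
  have hpol := hermForm_polarisation p T x y
  have h1 := hH (fun a => x a + y a)
  have h2 := hH (fun a => x a - y a)
  have h3 := hH (fun a => x a + Complex.I * y a)
  have h4 := hH (fun a => x a - Complex.I * y a)
  have hpar := sum_norm_sq_add_add_sum_norm_sq_sub T x y
  have hparI := sum_norm_sq_add_I_mul T x y
  have h4n : ‖(4 : ℂ) * ∑ a ∈ T, ∑ b ∈ T, ((legendreSym p ((a : ℤ) - b) : ℤ) : ℂ) * x a * conj (y b)‖ ≤
      θ * ∑ a ∈ T, ‖x a + y a‖ ^ 2 + θ * ∑ a ∈ T, ‖x a - y a‖ ^ 2 +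
      (θ * ∑ a ∈ T, ‖x a + Complex.I * y a‖ ^ 2 + θ * ∑ a ∈ T, ‖x a - Complex.I * y a‖ ^ 2) := by
    rw [hpol]
    refine (norm_add_le _ _).trans (add_le_add ((norm_sub_le _ _).trans (add_le_add h1 h2)) ?_)
    rw [norm_mul, Complex.norm_I, one_mul]
    exact (norm_sub_le _ _).trans (add_le_add h3 h4)
  rw [norm_mul] at h4n
  have h4' : ‖(4 : ℂ)‖ = 4 := by simp
  rw [h4', ← mul_add, ← mul_add, hpar, hparI] at h4n
  linarith

/-- **Hermitian bound ⇒ flat Paley-graph discrepancy** on subsets: if `|H(z)| ≤ θ Σ_{a∈T}|z_a|²` for all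
`z`, then `|Σ_{a∈A,b∈B} χ_p(a−b)| ≤ 2θ √(#A·#B)` for all `A, B ⊆ T` (polarisation on the
scaled indicators `s·1_A`, `s⁻¹·1_B`, `s⁴ = #B/#A`). [folklore] -/
theorem norm_diffCharSum_le_of_herm (θ : ℝ) (T : Finset ℕ)
    (hH : ∀ z : ℕ → ℂ, ‖∑ a ∈ T, ∑ b ∈ T, ((legendreSym p ((a : ℤ) - b) : ℤ) : ℂ) * z a * conj (z b)‖ ≤
      θ * ∑ a ∈ T, ‖z a‖ ^ 2)
    (A B : Finset ℕ) (hA : A ⊆ T) (hB : B ⊆ T) :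
    ‖∑ a ∈ A, ∑ b ∈ B, ((legendreSym p ((a : ℤ) - b) : ℤ) : ℂ)‖ ≤
      2 * θ * Real.sqrt ((A.card : ℝ) * B.card) := by
  classical
  -- degenerate cases
  rcases Nat.eq_zero_or_pos A.card with hA0 | hApos
  · rw [card_eq_zero.1 hA0]; simp
  rcases Nat.eq_zero_or_pos B.card with hB0 | hBpos
  · rw [card_eq_zero.1 hB0]; simp
  have hAR : (0 : ℝ) < A.card := by exact_mod_cast hApos
  have hBR : (0 : ℝ) < B.card := by exact_mod_cast hBpos
  -- scaling parameter `s > 0` with `s² = √#B / √#A`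
  set s : ℝ := Real.sqrt (Real.sqrt B.card / Real.sqrt A.card) with hs
  have hsA : 0 < Real.sqrt A.card := Real.sqrt_pos.2 hAR
  have hsB : 0 < Real.sqrt B.card := Real.sqrt_pos.2 hBR
  have hs2 : s ^ 2 = Real.sqrt B.card / Real.sqrt A.card := by
    rw [hs, Real.sq_sqrt (div_pos hsB hsA).le]
  have hspos : 0 < s := by rw [hs]; exact Real.sqrt_pos.2 (div_pos hsB hsA)
  have hsne : (s : ℂ) ≠ 0 := by exact_mod_cast hspos.ne'
  set x : ℕ → ℂ := fun a => if a ∈ A then (s : ℂ) else 0 with hx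
  set y : ℕ → ℂ := fun b => if b ∈ B then ((s : ℂ)⁻¹) else 0 with hy
  have hbil := norm_hermBilin_le_of_herm p θ T hH x y
  -- the bilinear sum against `x, y` is the flat sum (times `s · s⁻¹ = 1`)
  have hterm : ∀ a b : ℕ, ((legendreSym p ((a : ℤ) - b) : ℤ) : ℂ) * x a * conj (y b) =
      if a ∈ A then (if b ∈ B then ((legendreSym p ((a : ℤ) - b) : ℤ) : ℂ) else 0) else 0 := by
    intro a b
    simp only [hx, hy]
    split_ifs <;> simp [map_inv₀, Complex.conj_ofReal, hsne]
  have hsum : ∑ a ∈ T, ∑ b ∈ T, ((legendreSym p ((a : ℤ) - b) : ℤ) : ℂ) * x a * conj (y b) =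
      ∑ a ∈ A, ∑ b ∈ B, ((legendreSym p ((a : ℤ) - b) : ℤ) : ℂ) := by
    simp_rw [hterm]
    have hout : ∀ a ∈ T, (∑ b ∈ T, if a ∈ A then
        (if b ∈ B then ((legendreSym p ((a : ℤ) - b) : ℤ) : ℂ) else 0) else 0) =
        if a ∈ A then ∑ b ∈ B, ((legendreSym p ((a : ℤ) - b) : ℤ) : ℂ) else 0 := by
      intro a _
      split_ifs with ha
      · rw [← sum_filter, Finset.filter_mem_eq_inter, inter_eq_right.2 hB]
      · simp
    rw [sum_congr rfl hout, ← sum_filter, Finset.filter_mem_eq_inter, inter_eq_right.2 hA]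
  have hnx : ∑ a ∈ T, ‖x a‖ ^ 2 = s ^ 2 * A.card := by
    have h1 : ∀ a ∈ T, ‖x a‖ ^ 2 = if a ∈ A then s ^ 2 else 0 := by
      intro a _; simp only [hx]
      split_ifs
      · rw [Complex.norm_real, Real.norm_eq_abs, sq_abs]
      · simp
    rw [sum_congr rfl h1, ← sum_filter, Finset.filter_mem_eq_inter, inter_eq_right.2 hA]
    simp [mul_comm]
  have hny : ∑ b ∈ T, ‖y b‖ ^ 2 = (s ^ 2)⁻¹ * B.card := by
    have h1 : ∀ b ∈ T, ‖y b‖ ^ 2 = if b ∈ B then (s ^ 2)⁻¹ else 0 := by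
      intro b _; simp only [hy]
      split_ifs
      · rw [norm_inv, Complex.norm_real, Real.norm_eq_abs, inv_pow, sq_abs]
      · simp
    rw [sum_congr rfl h1, ← sum_filter, Finset.filter_mem_eq_inter, inter_eq_right.2 hB]
    simp [mul_comm]
  rw [hsum, hnx, hny, hs2] at hbil
  have hAe : Real.sqrt A.card * Real.sqrt A.card = A.card := Real.mul_self_sqrt hAR.le
  have hBe : Real.sqrt B.card * Real.sqrt B.card = B.card := Real.mul_self_sqrt hBR.le
  have hkey : Real.sqrt B.card / Real.sqrt A.card * A.card +
      (Real.sqrt B.card / Real.sqrt A.card)⁻¹ * B.card = 2 * (Real.sqrt A.card * Real.sqrt B.card) := by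
    field_simp
    nlinarith [hAe, hBe]
  rw [hkey] at hbil
  rw [Real.sqrt_mul (Nat.cast_nonneg _)]
  linarith

end Polarisation

section Asymptotic

/-- `2 ≤ p^{γ}` once `p ≥ ⌈2^{1/γ}⌉` (`γ > 0`). [folklore] -/
theorem two_le_rpow_of_le {γ : ℝ} (hγ : 0 < γ) {N p : ℕ} (hN : (2 : ℝ) ^ (1 / γ) ≤ (N : ℝ))
    (hp : N ≤ p) : (2 : ℝ) ≤ (p : ℝ) ^ γ := by
  have h0 : (0 : ℝ) ≤ (2 : ℝ) ^ (1 / γ) := Real.rpow_nonneg (by norm_num) _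
  have hpN : (N : ℝ) ≤ (p : ℝ) := by exact_mod_cast hp
  calc (2 : ℝ) = ((2 : ℝ) ^ (1 / γ)) ^ γ := by rw [one_div, Real.rpow_inv_rpow (by norm_num) hγ.ne']
    _ ≤ (p : ℝ) ^ γ := Real.rpow_le_rpow h0 (hN.trans hpN) hγ.le

/-- **Engine ⇒ Paley-ETF RIP beyond `√p`.**  From the registered statement of `stub_paleyFlatRIP`
(hypothesis, verbatim; exponents `(κ, δ₁)`) the Hermitian Paley-graph form is `p^{−κ}·√p`-bounded on
all supports `#S ≤ p^{1/2+δ₁/2}`: `|Σ_{a,b∈S} χ_p(a−b) x_a conj(x_b)| ≤ p^{1/2−κ} Σ|x_a|²` — i.e. every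
`p^{1/2+δ₁/2}`-column submatrix of the Paley ETF `Φ_p` (Gram matrix `I + p^{−1/2}(χ_p(a−b))`,
Bandeira–Fickus–Mixon–Wong 2013) has restricted-isometry constant `≤ p^{−κ}`. [folklore] -/
theorem paleyHermRIP_of_flatRIP
    (hB : ∃ κ : ℝ, 0 < κ ∧ ∃ δ₁ : ℝ, 0 < δ₁ ∧ ∃ p₁ : ℕ, ∀ (p : ℕ) [Fact p.Prime], p₁ ≤ p →
      ∀ (S : Finset ℕ), (∀ a ∈ S, a < p) → (S.card : ℝ) ≤ (p : ℝ) ^ (1 / 2 + δ₁) →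
      ∀ (w : ℕ → ℂ), ‖paleyForm p S w‖ ≤ (p : ℝ) ^ (1 / 2 - κ) * ∑ a ∈ S, ‖w a‖ ^ 2) :
    ∃ κ : ℝ, 0 < κ ∧ ∃ δ : ℝ, 0 < δ ∧ ∃ p₁ : ℕ, ∀ (p : ℕ) [Fact p.Prime], p₁ ≤ p →
      ∀ (S : Finset ℕ), (∀ a ∈ S, a < p) → (S.card : ℝ) ≤ (p : ℝ) ^ (1 / 2 + δ) →
      ∀ (x : ℕ → ℂ), ‖∑ a ∈ S, ∑ b ∈ S, ((legendreSym p ((a : ℤ) - b) : ℤ) : ℂ) * x a * conj (x b)‖ ≤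
        (p : ℝ) ^ (1 / 2 - κ) * ∑ a ∈ S, ‖x a‖ ^ 2 := by
  classical
  obtain ⟨κ, hκ, δ₁, hδ₁, p₁, hB⟩ := hB
  obtain ⟨N, hN⟩ : ∃ N : ℕ, (2 : ℝ) ^ (1 / (δ₁ / 2)) ≤ (N : ℝ) := ⟨_, Nat.le_ceil _⟩
  refine ⟨κ, hκ, δ₁ / 2, by positivity, max p₁ N, ?_⟩
  intro p _ hp S hS hScard x
  have hprime : p.Prime := Fact.out
  have hp0 : (0 : ℝ) < (p : ℝ) := by exact_mod_cast hprime.pos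
  have hp₁ : p₁ ≤ p := le_trans (le_max_left _ _) hp
  have h2 : (2 : ℝ) ≤ (p : ℝ) ^ (δ₁ / 2) :=
    two_le_rpow_of_le (by positivity) hN (le_trans (le_max_right _ _) hp)
  set T : Finset ℕ := S ∪ S.image (fun b : ℕ => (p - b) % p) with hT
  have hTp : ∀ a ∈ T, a < p := by
    intro a ha
    rcases mem_union.1 ha with h | h
    · exact hS a h
    · exact reflect_lt p S a h
  have hTcard : (T.card : ℝ) ≤ (p : ℝ) ^ (1 / 2 + δ₁) := by
    have h1 : (T.card : ℝ) ≤ (S.card : ℝ) + S.card := by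
      have := card_union_le S (S.image (fun b : ℕ => (p - b) % p))
      rw [card_reflect p S hS] at this
      exact_mod_cast this
    have h3 : (p : ℝ) ^ (1 / 2 + δ₁) = (p : ℝ) ^ (1 / 2 + δ₁ / 2) * (p : ℝ) ^ (δ₁ / 2) := by
      rw [← Real.rpow_add hp0]; ring_nf
    rw [h3]
    have h4 : 0 ≤ (p : ℝ) ^ (1 / 2 + δ₁ / 2) := Real.rpow_nonneg hp0.le _
    nlinarith
  exact norm_hermForm_le_of_flat p _ S hS (fun w => hB p hp₁ T hTp hTcard w) x

/-- **Paley-ETF RIP beyond `√p` ⇒ flat Paley-graph discrepancy beyond `√p`** (polarisation on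
`T = A ∪ B`, exponents `(κ/2, δ/2)`). [folklore] -/
theorem paleyDiffDiscrepancy_of_paleyHermRIP
    (hH : ∃ κ : ℝ, 0 < κ ∧ ∃ δ : ℝ, 0 < δ ∧ ∃ p₁ : ℕ, ∀ (p : ℕ) [Fact p.Prime], p₁ ≤ p →
      ∀ (S : Finset ℕ), (∀ a ∈ S, a < p) → (S.card : ℝ) ≤ (p : ℝ) ^ (1 / 2 + δ) →
      ∀ (x : ℕ → ℂ), ‖∑ a ∈ S, ∑ b ∈ S, ((legendreSym p ((a : ℤ) - b) : ℤ) : ℂ) * x a * conj (x b)‖ ≤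
        (p : ℝ) ^ (1 / 2 - κ) * ∑ a ∈ S, ‖x a‖ ^ 2) :
    ∃ κ : ℝ, 0 < κ ∧ ∃ δ : ℝ, 0 < δ ∧ ∃ p₁ : ℕ, ∀ (p : ℕ) [Fact p.Prime], p₁ ≤ p →
      ∀ (A B : Finset ℕ), (∀ a ∈ A, a < p) → (∀ b ∈ B, b < p) →
        (A.card : ℝ) ≤ (p : ℝ) ^ (1 / 2 + δ) → (B.card : ℝ) ≤ (p : ℝ) ^ (1 / 2 + δ) →
        ‖∑ a ∈ A, ∑ b ∈ B, ((legendreSym p ((a : ℤ) - b) : ℤ) : ℂ)‖ ≤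
          (p : ℝ) ^ (1 / 2 - κ) * Real.sqrt ((A.card : ℝ) * B.card) := by
  classical
  obtain ⟨κ, hκ, δ, hδ, p₁, hH⟩ := hH
  obtain ⟨N₁, hN₁⟩ : ∃ N : ℕ, (2 : ℝ) ^ (1 / (δ / 2)) ≤ (N : ℝ) := ⟨_, Nat.le_ceil _⟩
  obtain ⟨N₂, hN₂⟩ : ∃ N : ℕ, (2 : ℝ) ^ (1 / (κ / 2)) ≤ (N : ℝ) := ⟨_, Nat.le_ceil _⟩
  refine ⟨κ / 2, by positivity, δ / 2, by positivity, max p₁ (max N₁ N₂), ?_⟩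
  intro p _ hp A B hA hBp hAc hBc
  have hprime : p.Prime := Fact.out
  have hp0 : (0 : ℝ) < (p : ℝ) := by exact_mod_cast hprime.pos
  have hp₁ : p₁ ≤ p := le_trans (le_max_left _ _) hp
  have h2δ : (2 : ℝ) ≤ (p : ℝ) ^ (δ / 2) :=
    two_le_rpow_of_le (by positivity) hN₁ (le_trans (le_trans (le_max_left _ _) (le_max_right _ _)) hp)
  have h2κ : (2 : ℝ) ≤ (p : ℝ) ^ (κ / 2) :=
    two_le_rpow_of_le (by positivity) hN₂ (le_trans (le_trans (le_max_right _ _) (le_max_right _ _)) hp)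
  set T : Finset ℕ := A ∪ B with hT
  have hTp : ∀ a ∈ T, a < p := by
    intro a ha
    rcases mem_union.1 ha with h | h
    · exact hA a h
    · exact hBp a h
  have hTcard : (T.card : ℝ) ≤ (p : ℝ) ^ (1 / 2 + δ) := by
    have h1 : (T.card : ℝ) ≤ (A.card : ℝ) + B.card := by exact_mod_cast card_union_le A B
    have h3 : (p : ℝ) ^ (1 / 2 + δ) = (p : ℝ) ^ (1 / 2 + δ / 2) * (p : ℝ) ^ (δ / 2) := by
      rw [← Real.rpow_add hp0]; ring_nf
    rw [h3]
    have h4 : 0 ≤ (p : ℝ) ^ (1 / 2 + δ / 2) := Real.rpow_nonneg hp0.le _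
    nlinarith
  have hflat := norm_diffCharSum_le_of_herm p _ T (fun z => hH p hp₁ T hTp hTcard z) A B
    subset_union_left subset_union_right
  -- `2 p^{1/2−κ} ≤ p^{1/2−κ/2}`
  have hsplit : (p : ℝ) ^ (1 / 2 - κ / 2) = (p : ℝ) ^ (1 / 2 - κ) * (p : ℝ) ^ (κ / 2) := by
    rw [← Real.rpow_add hp0]; ring_nf
  refine hflat.trans (mul_le_mul_of_nonneg_right ?_ (Real.sqrt_nonneg _))
  rw [hsplit]
  have h0 : 0 ≤ (p : ℝ) ^ (1 / 2 - κ) := Real.rpow_nonneg hp0.le _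
  nlinarith

/-- **The engine ⟺ the Paley-ETF restricted isometry property beyond the square-root bottleneck** (as
`∃`-statements over the exponents): `stub_paleyFlatRIP` holds iff there are `κ, δ > 0` such that for all
large primes `p`, all `S ⊆ [0,p)` with `#S ≤ p^{1/2+δ}` and all `x : S → ℂ`,
`|Σ_{a,b∈S} χ_p(a−b) x_a conj(x_b)| ≤ p^{1/2−κ}‖x‖²` — equivalently `δ_K(Φ_p) ≤ p^{−κ}` at order
`K = p^{1/2+δ}` for the Paley ETF `Φ_p` (BFMW 2013 §6; Bandeira–Mixon–Moreira 2017; Conjecture 14 of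
arXiv:2603.29571, open).  `→`: reflection + block polarisation; `←`: sesquilinear polarisation ⇒ flat
Paley-graph discrepancy ⇒ engine (`flatRIP_iff_paleyDiffDiscrepancy`). [folklore] -/
theorem flatRIP_iff_paleyHermRIP :
    (∃ κ : ℝ, 0 < κ ∧ ∃ δ₁ : ℝ, 0 < δ₁ ∧ ∃ p₁ : ℕ, ∀ (p : ℕ) [Fact p.Prime], p₁ ≤ p →
      ∀ (S : Finset ℕ), (∀ a ∈ S, a < p) → (S.card : ℝ) ≤ (p : ℝ) ^ (1 / 2 + δ₁) →
      ∀ (w : ℕ → ℂ), ‖paleyForm p S w‖ ≤ (p : ℝ) ^ (1 / 2 - κ) * ∑ a ∈ S, ‖w a‖ ^ 2) ↔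
    (∃ κ : ℝ, 0 < κ ∧ ∃ δ : ℝ, 0 < δ ∧ ∃ p₁ : ℕ, ∀ (p : ℕ) [Fact p.Prime], p₁ ≤ p →
      ∀ (S : Finset ℕ), (∀ a ∈ S, a < p) → (S.card : ℝ) ≤ (p : ℝ) ^ (1 / 2 + δ) →
      ∀ (x : ℕ → ℂ), ‖∑ a ∈ S, ∑ b ∈ S, ((legendreSym p ((a : ℤ) - b) : ℤ) : ℂ) * x a * conj (x b)‖ ≤
        (p : ℝ) ^ (1 / 2 - κ) * ∑ a ∈ S, ‖x a‖ ^ 2) :=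
  ⟨paleyHermRIP_of_flatRIP,
    fun h => flatRIP_iff_paleyDiffDiscrepancy.2 (paleyDiffDiscrepancy_of_paleyHermRIP h)⟩

end Asymptotic

end

end Summit.ValiantsHypothesis.ValiantsHypothesis.Theorems.FeketeSOSHardPaleyRIP
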